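import Literature.IUT.HodgeTheaters.StableCurveTemperedDataOfSpecialFibreProp24OfPiData
import Literature.IUT.HodgeTheaters.TemperedCoveringsProp24StrongTorsionFree
import HarnessLib

/-!
# [IUTchI] Prop. 2.4 (i) at the genuine 𝔛-datum: the two abelianization laws in their PRINTED form,
# on L3's origin objects

Mochizuki, *Inter-universal Teichmüller theory I*, kurims manuscript (May 2020), §2, proof of Prop. 2.4 (i),
p. 50 l. 27 ("since [as is well-known — cf., e.g., [Config], Remark 1.2.2] `Δ̂_X` is *strongly torsion-free*")
and p. 50 l. 31–33 ("our assumption that `p ∉ Σ` implies that the surjection `J ↠ Π^tp_{𝔾_J}` induces an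
isomorphism between the pro-`Σ` completions of the respective abelianizations")
[cite: Mochizuki2012, Prop 2.4(i) p.50] (D-0012 claim key; nothing of the series is asserted here), over
Mochizuki, *Semi-graphs of anabelioids*, Publ. RIMS **42** (2006), Ex. 3.10 pp. 44–45
[cite: MochizukiSemiAnbd2006, Ex 3.10 p.44].

PROOF-ONLY companion (abc-iut-L5-t11; no definitions, no new `Prop` fact) of the sub-DAG file
`TemperedCoveringsProp24Sub.lean` (abc-iut-w5-d119) and of the genuine-datum tower files.  After
`StableCurveTemperedDataOfSpecialFibreTowerComplete.lean` / `…Prop24OfPiData.lean` (abc-iut-f-193: (INV) discharged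
modulo `hadm`), the laws of [IUTchI] Prop. 2.4 (i) at `StableCurveTemperedData.ofSpecialFibre X d S …` over the
origin record `P : SpecialFibreTower.PiData X d S T` are `hstf` · `hA3` · `hspec` · `hadm` (+ `hLev` for (ii)).  Two of
them, `hstf : StronglyTorsionFreeSigma` and `hspec : SpecializationAb`, are phrased in the sub-DAG's ad-hoc vocabulary
(characters of open subgroups of `Δ̂_X`, resp. of the levels `Ĵ_i ∩ Δ̂_X` of the L5 tower).  HERE they are reduced to
their PRINTED forms stated on abc-iut-L3's objects ONLY:
* `Prop24Tower.specializationAb_of_levelCharacters` — at the abstract sub-DAG level, (L2b) `SpecializationAb` follows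
  from "every continuous character of the level `J_i` with values in a finite abelian `Σ`-group kills
  `Ker(J_i ↠ Π^tp_{𝔾_{J_i}})`" (pull the detecting character of `Ĵ_i ∩ Δ̂_X` back along `ι_Δ`);
* `specializationAb_ofSpecialFibre_of_characters (hab)` — at the genuine datum, `hspec` follows from
  `hab : ∀ i A χ, … → Ker(adm_i) ≤ Ker χ` for continuous characters `χ : N_i → A` into finite abelian `Σ`-groups,
  i.e. the injectivity half of the printed "isomorphism between the pro-`Σ` completions of the respective
  abelianizations" for L3's admissible quotients `adm i : N_i ↠ π₁^temp(𝒢_i)` — no `Ĵ`, no closure, no tower;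
* `stronglyTorsionFreeSigma_ofSpecialFibre_of_torsionFreeAb (hTF)` — `hstf` follows from the printed [Config]
  Rmk. 1.2.2 form "every open subgroup of `Δ̂_X` has torsion-free abelianization" on L3's `X.DeltaHat`
  (abc-iut-w4-d055's `stronglyTorsionFreeSigma_of_torsionFreeAb`, its side conditions discharged at the datum);
* `prop24_cor25_ofPiData_of_printedLaws` — abc-iut-f-193's one-call form of Prop. 2.4 (i)(ii)(iii) ∧ Cor. 2.5 at the
  genuine datum with `hstf`/`hspec` so supplied: laws `hTF` · `hA3` · `hab` · `hadm` · `hLev`, every one a statement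
  about `X.DeltaHat`, `T.N i`, `T.adm i`, `T.admKer i` or the level charts.
CONDITIONAL, as labelled: every theorem below is conditional on its law binders and on the origin data
`P : SpecialFibreTower.PiData X d S T`, which the tree inhabits at MODEL towers only (abc-iut-L3-t2,
`SpecialFibreTower.PiData.nonempty_of_charLevels`), at no genuine curve.  Typed ≠ discharged for the laws; nothing here
asserts that abc is proved or refuted, and nothing here bears on [IUTchIII] Cor. 3.12.
-/

noncomputable section

namespace Literature.IUT.HodgeTheaters

open _root_.Topology
open scoped Pointwise
open Literature.AnabelianGeometry.SemiGraphs Literature.AnabelianGeometry.SemiGraphs.ProfiniteSemiGraph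

namespace StableCurveTemperedData

universe u

/-! ### (L2b) at the abstract sub-DAG level: characters of the tempered level suffice -/

namespace Prop24Tower

variable {D : StableCurveTemperedData.{u}} (T : D.Prop24Tower)

/-- **(L2b) `SpecializationAb` from characters of the tempered levels**: if, at every level `i`, every
continuous character `χ` of `J_i = Δ^tp_X ∩ ι⁻¹(Ĵ_i)` with values in a finite abelian `Σ`-group kills
`Ker(J_i ↠ Π^tp_{𝔾_{J_i}})`, then an element of `J_i` killed by `J_i ↠ Π^tp_{𝔾_{J_i}}` is detected by no
continuous `Σ`-character of `Ĵ_i ∩ Δ̂_X` (restrict the character along `ι_Δ`).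
([IUTchI] Prop 2.4(i) p.50) [claim: Mochizuki2012, status: disputed] -/
theorem specializationAb_of_levelCharacters
    (hab : ∀ (i : T.I) (A : Type u) [CommGroup A] [Finite A] (χ : D.levelTp (T.Jhat i) →* A),
      IsOpen ((χ.ker : Subgroup (D.levelTp (T.Jhat i))) : Set (D.levelTp (T.Jhat i))) →
      (∀ q : ℕ, q.Prime → q ∣ Nat.card A → q ∈ D.graph.Sigma) → (T.πtp i).ker ≤ χ.ker) :
    T.SpecializationAb := by
  intro i x hx h1 hdet
  obtain ⟨A, _, _, χ, hopen, hS, hne⟩ := hdet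
  -- the restriction `ψ : J_i → Ĵ_i ∩ Δ̂_X` of `ι_Δ`
  let ψ : D.levelTp (T.Jhat i) →* ((T.Jhat i).subgroupOf D.DeltaHat) :=
    { toFun := fun y => ⟨D.ιΔ (y : D.DeltaTp), y.2⟩
      map_one' := Subtype.ext (map_one _)
      map_mul' := fun a b => Subtype.ext (map_mul _ _ _) }
  have hψ : Continuous ψ :=
    Continuous.subtype_mk (D.continuous_ιΔ.comp continuous_subtype_val) _
  have hopen' : IsOpen (((χ.comp ψ).ker : Subgroup (D.levelTp (T.Jhat i))) :
      Set (D.levelTp (T.Jhat i))) := by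
    have e : (((χ.comp ψ).ker : Subgroup (D.levelTp (T.Jhat i))) : Set (D.levelTp (T.Jhat i))) =
        ψ ⁻¹' ((χ.ker : Subgroup ((T.Jhat i).subgroupOf D.DeltaHat)) : Set _) := by
      ext y
      simp only [SetLike.mem_coe, MonoidHom.mem_ker, MonoidHom.coe_comp, Function.comp_apply,
        Set.mem_preimage]
    rw [e]
    exact hopen.preimage hψ
  have hker : (⟨x, hx⟩ : D.levelTp (T.Jhat i)) ∈ (χ.comp ψ).ker :=
    hab i A (χ.comp ψ) hopen' hS (by rw [MonoidHom.mem_ker]; exact h1)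
  rw [MonoidHom.mem_ker] at hker
  exact hne hker

end Prop24Tower

/-! ### At the genuine 𝔛-datum -/

namespace OfSpecialFibre

variable {p : ℕ} [Fact p.Prime] (X : TemperedCurve p) (d : X.GroupLevelData)
  (T : SpecialFibreTower X.DeltaTemp)
  (Sigma SigmaHat : Set ℕ) (hsub : Sigma ⊆ SigmaHat) (hne : Set.Nonempty Sigma)
  (hprime : ∀ q ∈ SigmaHat, q.Prime)
  (S : SpecialFibreData (X.toTemperedArithmeticGroup d)) (h36 : S.Gc.Prop36Hypotheses)
  (hp : p ∉ Sigma) (TpH : Subgroup S.chart.G)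
  (HatH : Subgroup (TemperedGraphGroupData.exists_completion_of_prop36 S.Gc h36 S.chart).choose)
  (hle : TpH.map (TemperedGraphGroupData.exists_completion_of_prop36 S.Gc h36
    S.chart).choose_spec.choose.toMonoidHom ≤ HatH)
  (cuspMeetsH : {x : X.Pt // X.IsCusp x} → Prop)

/-- **(L2b) `SpecializationAb` at the genuine datum from the PRINTED abelianization statement on L3's record**:
if for every level `i` every continuous character `χ : N_i → A` with values in a finite abelian `Σ`-group kills
`admKer_i = Ker(adm_i : N_i ↠ π₁^temp(𝒢_i))` ("`J ↠ Π^tp_{𝔾_J}` induces an isomorphism between the pro-`Σ`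
completions of the respective abelianizations", p. 50 l. 31–33 — the injectivity half), then the tower
`towerOfSpecialFibreTower` satisfies `SpecializationAb` (the level `J_i` of the datum IS `N_i`, `levelToN`).
([IUTchI] Prop 2.4(i) p.50) [claim: Mochizuki2012, status: disputed] -/
theorem specializationAb_ofSpecialFibre_of_characters
    (hab : ∀ (i : ℕ) (A : Type) [CommGroup A] [Finite A] (χ : T.N i →* A),
      IsOpen ((χ.ker : Subgroup (T.N i)) : Set (T.N i)) →
      (∀ q : ℕ, q.Prime → q ∣ Nat.card A → q ∈ Sigma) → (T.adm i).toMonoidHom.ker ≤ χ.ker) :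
    (towerOfSpecialFibreTower X d T Sigma SigmaHat hsub hne hprime S h36 hp TpH HatH hle
      cuspMeetsH).SpecializationAb := by
  refine Prop24Tower.specializationAb_of_levelCharacters _ ?_
  intro i A _ _ χ hopen hS
  change ℕ at i
  change ↥((ofSpecialFibre X d S h36 Sigma SigmaHat hsub hne hprime hp TpH HatH hle cuspMeetsH).levelTp
      (levelJhat X T i)) →* A at χ
  change ∀ q : ℕ, q.Prime → q ∣ Nat.card A → q ∈ Sigma at hS
  change (piTpLevel X d T Sigma SigmaHat hsub hne hprime S h36 hp TpH HatH hle cuspMeetsH i).ker ≤ χ.ker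
  -- the identification `N_i → J_i` inverse to `levelToN`
  let ν : T.N i →* (ofSpecialFibre X d S h36 Sigma SigmaHat hsub hne hprime hp TpH HatH hle cuspMeetsH).levelTp
      (levelJhat X T i) :=
    { toFun := fun n => ⟨⟨((n : X.DeltaTemp) : X.PiTemp),
          (show ((n : X.DeltaTemp) : X.PiTemp) ∈ X.augGK.toMonoidHom.ker by
            rw [ker_augGK_eq_deltaTemp]; exact (n : X.DeltaTemp).2)⟩,
        (toHat_mem_levelJhat_iff X d T i _).2 n.2⟩
      map_one' := Subtype.ext (Subtype.ext rfl)
      map_mul' := fun _ _ => Subtype.ext (Subtype.ext rfl) }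
  have hν : Continuous ν := by
    refine Continuous.subtype_mk ?_ _
    exact Continuous.subtype_mk (continuous_subtype_val.comp continuous_subtype_val) _
  -- the character `χ ∘ ν` of `N_i` is continuous, hence kills `admKer_i`
  have hopen' : IsOpen ((((χ.comp ν).ker : Subgroup (T.N i))) : Set (T.N i)) := hopen.preimage hν
  have hle' : (T.adm i).toMonoidHom.ker ≤ (χ.comp ν).ker := hab i A (χ.comp ν) hopen' hS
  intro y hy
  have hy' : levelToN X d T Sigma SigmaHat hsub hne hprime S h36 hp TpH HatH hle cuspMeetsH i y ∈
      (T.adm i).toMonoidHom.ker := hy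
  have h2 : χ (ν (levelToN X d T Sigma SigmaHat hsub hne hprime S h36 hp TpH HatH hle cuspMeetsH i y)) = 1 :=
    hle' hy'
  have hνl : ν (levelToN X d T Sigma SigmaHat hsub hne hprime S h36 hp TpH HatH hle cuspMeetsH i y) = y :=
    Subtype.ext (Subtype.ext rfl)
  rw [hνl] at h2
  exact h2

/-- **"`Δ̂_X` is strongly torsion-free" at the genuine datum from the PRINTED [Config] Rmk. 1.2.2 form on L3's
`Δ_X = X.DeltaHat`**: every open subgroup of `X.DeltaHat` has torsion-free abelianization (character form, all finite
abelian targets) ⟹ `StronglyTorsionFreeSigma` for `ofSpecialFibre X d S …` (abc-iut-w4-d055's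
`stronglyTorsionFreeSigma_of_torsionFreeAb`; `Π̂_X = X.PiHat` is profinite and `Δ̂_X = Ker(Π̂_X → G_k) = X.DeltaHat` is
closed at the datum). ([IUTchI] Prop 2.4(i) p.50) [claim: Mochizuki2012, status: disputed] -/
theorem stronglyTorsionFreeSigma_ofSpecialFibre_of_torsionFreeAb
    (hTF : ∀ H : Subgroup X.DeltaHat, IsOpen (H : Set X.DeltaHat) →
      ∀ (h : H) (n : ℕ), n ≠ 0 →
        SigmaCharDetects Set.univ H h → SigmaCharDetects Set.univ H (h ^ n)) :
    (ofSpecialFibre X d S h36 Sigma SigmaHat hsub hne hprime hp TpH HatH hle cuspMeetsH).StronglyTorsionFreeSigma := by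
  haveI : TotallyDisconnectedSpace X.PiHat := X.isProfiniteCompletion_toHat.totallyDisconnectedSpace
  refine stronglyTorsionFreeSigma_of_torsionFreeAb
    (ofSpecialFibre_deltaHatClosed X d Sigma SigmaHat hsub hne hprime S h36 hp TpH HatH hle cuspMeetsH) ?_
  change ∀ H : Subgroup (augHatGK X).ker, IsOpen (H : Set (augHatGK X).ker) →
      ∀ (h : H) (n : ℕ), n ≠ 0 →
        SigmaCharDetects Set.univ H h → SigmaCharDetects Set.univ H (h ^ n)
  rw [ker_augHatGK_eq_deltaHat X d]
  exact hTF

/-- **[IUTchI] Prop. 2.4 (i)(ii)(iii) ∧ Cor. 2.5 AS TYPED at the genuine 𝔛-datum carrying `P`, every law in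
PRINTED form on L3's objects** — abc-iut-f-193's `prop24_cor25_ofPiData_of_admKer_nhds_one` with
`hstf := stronglyTorsionFreeSigma_ofSpecialFibre_of_torsionFreeAb … hTF` and
`hspec := specializationAb_ofSpecialFibre_of_characters … hab`.  Laws: `hTF` ([Config] Rmk. 1.2.2 on `X.DeltaHat`) ·
`hA3` ((A3) at the level charts) · `hab` (pro-`Σ` abelianizations along `adm i`) · `hadm` (the admissible kernels
shrink to `1`) · `hLev` (arithmetic Prop. 2.1 per level); DATA `P`, a cusp `x`, verticial families `Λv` and node data.
([IUTchI] Prop 2.4, Cor 2.5 pp.50-51) [claim: Mochizuki2012, status: disputed] -/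
theorem prop24_cor25_ofPiData_of_printedLaws (P : SpecialFibreTower.PiData X d S T)
    (x : {x : X.Pt // X.IsCusp x})
    (hTF : ∀ H : Subgroup X.DeltaHat, IsOpen (H : Set X.DeltaHat) →
      ∀ (h : H) (n : ℕ), n ≠ 0 →
        SigmaCharDetects Set.univ H h → SigmaCharDetects Set.univ H (h ^ n))
    (Λv : ∀ i, (T.Gc i).graph.Vertex → Subgroup (T.chart i).G)
    (hΛv : ∀ i v, Λv i v ∈ verticialSubgroups (T.chart i) v)
    (E : ℕ → Type) (src tgt : ∀ i, E i → (T.Gc i).graph.Vertex) (c₁ c₂ : ∀ i, E i → (T.chart i).G)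
    (hA3 : ∀ i (v w : (T.Gc i).graph.Vertex) (g h : (levelGraph X T Sigma SigmaHat hsub hne hprime i).Hat),
      MulAut.conj g • (Λv i v).map (levelGraph X T Sigma SigmaHat hsub hne hprime i).ι ⊓
          MulAut.conj h • (Λv i w).map (levelGraph X T Sigma SigmaHat hsub hne hprime i).ι ≠ ⊥ →
        (v = w ∧ g⁻¹ * h ∈ (Λv i v).map (levelGraph X T Sigma SigmaHat hsub hne hprime i).ι) ∨
        ∃ (e : E i) (k : (levelGraph X T Sigma SigmaHat hsub hne hprime i).Hat),
          ∃ p ∈ (Λv i (src i e)).map (levelGraph X T Sigma SigmaHat hsub hne hprime i).ι,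
          ∃ q ∈ (Λv i (tgt i e)).map (levelGraph X T Sigma SigmaHat hsub hne hprime i).ι,
            (src i e = v ∧ tgt i e = w ∧
                g = k * (levelGraph X T Sigma SigmaHat hsub hne hprime i).ι (c₁ i e) * p ∧
                h = k * (levelGraph X T Sigma SigmaHat hsub hne hprime i).ι (c₂ i e) * q) ∨
            (src i e = w ∧ tgt i e = v ∧
                h = k * (levelGraph X T Sigma SigmaHat hsub hne hprime i).ι (c₁ i e) * p ∧
                g = k * (levelGraph X T Sigma SigmaHat hsub hne hprime i).ι (c₂ i e) * q))
    (hab : ∀ (i : ℕ) (A : Type) [CommGroup A] [Finite A] (χ : T.N i →* A),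
      IsOpen ((χ.ker : Subgroup (T.N i)) : Set (T.N i)) →
      (∀ q : ℕ, q.Prime → q ∣ Nat.card A → q ∈ Sigma) → (T.adm i).toMonoidHom.ker ≤ χ.ker)
    (hadm : ∀ U ∈ 𝓝 (1 : ↥X.DeltaTemp), ∃ j, ((T.admKer j : Subgroup ↥X.DeltaTemp) : Set ↥X.DeltaTemp) ⊆ U)
    (hLev : (qTowerOfSpecialFibreTower X T d S h36 Sigma SigmaHat hsub hne hprime hp TpH HatH hle cuspMeetsH
      P.admKer_normal_pi).LevelObservation) :
    ((ofSpecialFibre X d S h36 Sigma SigmaHat hsub hne hprime hp TpH HatH hle cuspMeetsH).Prop24i ∧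
      (ofSpecialFibre X d S h36 Sigma SigmaHat hsub hne hprime hp TpH HatH hle cuspMeetsH).Prop24ii ∧
      (ofSpecialFibre X d S h36 Sigma SigmaHat hsub hne hprime hp TpH HatH hle cuspMeetsH).Prop24iii) ∧
    ((ofSpecialFibre X d S h36 Sigma SigmaHat hsub hne hprime hp TpH HatH hle cuspMeetsH).Cor25Decomposition ∧
      (ofSpecialFibre X d S h36 Sigma SigmaHat hsub hne hprime hp TpH HatH hle cuspMeetsH).Cor25Inertia) :=
  prop24_cor25_ofPiData_of_admKer_nhds_one X d T Sigma SigmaHat hsub hne hprime S h36 hp TpH HatH hle cuspMeetsH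
    P x (stronglyTorsionFreeSigma_ofSpecialFibre_of_torsionFreeAb X d Sigma SigmaHat hsub hne hprime S h36 hp TpH
      HatH hle cuspMeetsH hTF)
    Λv hΛv E src tgt c₁ c₂ hA3
    (specializationAb_ofSpecialFibre_of_characters X d T Sigma SigmaHat hsub hne hprime S h36 hp TpH HatH hle
      cuspMeetsH hab)
    hadm hLev

end OfSpecialFibre

end StableCurveTemperedData

end Literature.IUT.HodgeTheaters

end
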